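import Summits.SmoothPoincare4.SmoothPoincare4.Theorems.EntropyRungConicalGapGradScalarBound
import Summits.SmoothPoincare4.SmoothPoincare4.Theorems.EntropyRungConicalGapRicciMomentIdentity
import Literature.Geometry.Lorentzian.RicciNormSq
import Literature.Geometry.Lorentzian.ChartLaplacian
import HarnessLib

/-!
# Helper `helper_ricciNormSq_cutoff_integral_le` of line `Sketch` — the cut-off inequality behind the
# weighted `L²` bound for `Ric` (crux `EntropyRung.ConicalGap`, stmt-SmoothPoincare4-16589; lead seat c4, cycle 4)

**The cut-off step of Munteanu–Sesum's weighted `L²` bound for the Ricci tensor** (J. Geom. Anal. 23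
(2013), proof of Thm. 1.5 / Thm. 1.4: `∫_M |Ric|² e^{-λ f} < ∞` for every `λ > 0`), at the weight
`v = e^{-f/τ}`, any dimension `n`. On a gradient shrinker `Ric + Hess f = g/2`, `R + |∇f|² = f`, with
proper potential and `R ≥ 0`, let `φ` be a smooth profile vanishing on `[2, ∞)` with `0 ≤ φ ≤ 1`,
`|φ′| ≤ C`, let `ρ ≥ 1` and `u = φ(f/ρ)² v = Ψ(f)`, `Ψ(t) = φ(t/ρ)² e^{-t/τ}` — a `C¹` function of
compact support. Hamilton's identity `ΔR = g⁻¹(dR, df) + R − 2|Ric|²`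
(`dalembertian_scalarCurvature_of_soliton`) and Green's first identity for `u`
(`integral_mul_dalembertian_eq_neg_integral_innerDual_of_hasCompactSupport`, `du = Ψ′(f) df`) give

  `2 ∫ u |Ric|² = ∫ u R + ∫ (u + Ψ′(f)) g⁻¹(dR, df)`,  `u + Ψ′(f) = v φ (φ (1 − τ⁻¹) + 2 φ′/ρ)`,

and Cauchy–Schwarz `g⁻¹(dR, df)² = 4 Ric(∇f,∇f)² ≤ 4 |Ric|² |∇f|⁴` (`gradScalarBound_innerDual_sq_le`)
with `|∇f|² = f − R ≤ f` bounds the last integrand by `v (½ φ² |Ric|² + 2 C′² f²)`,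
`C′ = |1 − τ⁻¹| + 2C`; absorbing,

  `∫ φ(f/ρ)² |Ric|² e^{-f/τ} dV ≤ ⅔ (∫ R e^{-f/τ} dV + 2 C′² ∫ f² e^{-f/τ} dV)`  uniformly in `ρ`

(`ricciNormSq_cutoff_integral_le`; registered 4-d form `helper_ricciNormSq_cutoff_integral_le`). The
Fatou step `ρ → ∞` is `EntropyRungConicalGapRicciNormSqIntegrable.lean`. Everything here is proved; no
definition and no named fact is introduced.

## References

* O. Munteanu, N. Sesum, *On gradient Ricci solitons*, J. Geom. Anal. 23 (2013) 539–561, Thm. 1.4,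
  Thm. 1.5 and their proofs (the weighted `L²` bounds `∫ |Ric|² e^{-λf} < ∞`). [MunteanuSesum2013]
* O. Munteanu, J. Wang, *Structure at infinity for shrinking Ricci solitons*, arXiv:1606.01861, §2
  (p. 6) (`Δ_f R = R − 2|Ric|²`, `∇R = 2Ric(∇f)`). [MunteanuWang2016]
* [CarrilloNi2009] J. Carrillo, L. Ni, Comm. Anal. Geom. 17 (2009) 721–753, §2, Cor. 2.1 (cut-off
  technique).
-/

noncomputable section

-- `Summit.SmoothPoincare4.SmoothPoincare4.…` (summit = problem) trips `dupNamespace` on every decl.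
set_option linter.dupNamespace false

open scoped Manifold ContDiff ENNReal NNReal Topology
open MeasureTheory Set Filter
open Literature.Geometry.Lorentzian Literature.Geometry.Riemannian

namespace Summit.SmoothPoincare4.SmoothPoincare4.Theorems.ConicalGapSketch

open CarrilloNi2009_shrinkerLSI

/-! ## The cut-off inequality over `g.riemVolume` (any dimension) -/

section ProperGreen

variable {n : ℕ} {M : Type*} [TopologicalSpace M] [ChartedSpace (EuclideanSpace ℝ (Fin n)) M]
  [IsManifold (𝓡 n) ∞ M] [T3Space M] [MeasurableSpace M] [BorelSpace M]
  {g : PseudoRiemannianMetric (𝓡 n) ∞ (EuclideanSpace ℝ (Fin n)) (TangentSpace (𝓡 n) : M → Type _)}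
  {f : M → ℝ} [g.HasLeviCivita]

omit [T3Space M] [MeasurableSpace M] [BorelSpace M] in
/-- **Pointwise bound `|g⁻¹(dR, df)| ≤ 2 √|Ric|² · f`** on a normalised gradient shrinker with `R ≥ 0`:
`g⁻¹(dR, df)² ≤ 4 |Ric|² (|∇f|²)²` (`gradScalarBound_innerDual_sq_le`) and `0 ≤ |∇f|² = f − R ≤ f`. -/
theorem ricciNormSq_abs_innerDual_le (hg : g.IsRiemannian) (hf : ContMDiff (𝓡 n) 𝓘(ℝ, ℝ) ∞ f)
    (hsol : ∀ (x : M) (X Y : TangentSpace (𝓡 n) x),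
      g.ricci x X Y + g.hessian f x X Y = (1 / 2 : ℝ) * g.val x X Y)
    (hnorm : ∀ x : M, g.scalarCurvature x + g.gradSq f x = f x) (hR0 : ∀ x, 0 ≤ g.scalarCurvature x)
    (x : M) :
    |g.innerDual x (mvfderiv (𝓡 n) g.scalarCurvature x).toLinearMap
        (mvfderiv (𝓡 n) f x).toLinearMap| ≤
      2 * Real.sqrt (g.normSq x (g.ricci x)) * f x := by
  have hsq := gradScalarBound_innerDual_sq_le hg hf hsol x
  have hN0 : 0 ≤ g.normSq x (g.ricci x) := g.normSq_nonneg x hg _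
  have hB0 : 0 ≤ g.gradSq f x := g.gradSq_nonneg hg f x
  have hBle : g.gradSq f x ≤ f x := by linarith [hnorm x, hR0 x]
  have hs0 : 0 ≤ Real.sqrt (g.normSq x (g.ricci x)) := Real.sqrt_nonneg _
  have hss : Real.sqrt (g.normSq x (g.ricci x)) ^ 2 = g.normSq x (g.ricci x) := Real.sq_sqrt hN0
  -- `|X| ≤ 2 √N |∇f|²`
  have hb0 : 0 ≤ 2 * Real.sqrt (g.normSq x (g.ricci x)) * g.gradSq f x := by positivity
  have h1 : |g.innerDual x (mvfderiv (𝓡 n) g.scalarCurvature x).toLinearMap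
      (mvfderiv (𝓡 n) f x).toLinearMap| ≤ 2 * Real.sqrt (g.normSq x (g.ricci x)) * g.gradSq f x := by
    rw [← Real.sqrt_sq_eq_abs]
    calc Real.sqrt ((g.innerDual x (mvfderiv (𝓡 n) g.scalarCurvature x).toLinearMap
          (mvfderiv (𝓡 n) f x).toLinearMap) ^ 2)
        ≤ Real.sqrt ((2 * Real.sqrt (g.normSq x (g.ricci x)) * g.gradSq f x) ^ 2) :=
          Real.sqrt_le_sqrt (by rw [mul_pow, mul_pow, hss]; linarith [hsq])
      _ = 2 * Real.sqrt (g.normSq x (g.ricci x)) * g.gradSq f x := Real.sqrt_sq hb0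
  exact h1.trans (mul_le_mul_of_nonneg_left hBle (by positivity))

/-- **The cut-off inequality** (Munteanu–Sesum 2013, proof of Thm. 1.5, with the weight `e^{-f/τ}`):
for `g` Riemannian, `f` smooth and proper with `Ric + Hess f = g/2`, `R + |∇f|² = f`, `R ≥ 0`, a smooth
profile `φ` vanishing on `[2, ∞)` with `0 ≤ φ ≤ 1`, `|φ′| ≤ C`, and `ρ ≥ 1`, `τ > 0`:
`∫ φ(f/ρ)² |Ric|² e^{-f/τ} dV ≤ ⅔ (∫ R e^{-f/τ} dV + 2 (|1 − τ⁻¹| + 2C)² ∫ f² e^{-f/τ} dV)`. -/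
theorem ricciNormSq_cutoff_integral_le (hg : g.IsRiemannian) (hf : ContMDiff (𝓡 n) 𝓘(ℝ, ℝ) ∞ f)
    (hsol : ∀ (x : M) (X Y : TangentSpace (𝓡 n) x),
      g.ricci x X Y + g.hessian f x X Y = (1 / 2 : ℝ) * g.val x X Y)
    (hnorm : ∀ x : M, g.scalarCurvature x + g.gradSq f x = f x)
    (hprop : ∀ R : ℝ, IsCompact {x | f x ≤ R}) (hR0 : ∀ x, 0 ≤ g.scalarCurvature x)
    {φ : ℝ → ℝ} (hφs : ContDiff ℝ ∞ φ) (hφ0 : ∀ t, 2 ≤ t → φ t = 0)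
    (hφ01 : ∀ t, 0 ≤ φ t ∧ φ t ≤ 1) {C : ℝ} (hC : ∀ t, |deriv φ t| ≤ C) {ρ : ℝ} (hρ : 1 ≤ ρ)
    {τ : ℝ} (hτ : 0 < τ) :
    ∫ x, φ (f x / ρ) ^ 2 * (g.normSq x (g.ricci x) * Real.exp (-f x / τ)) ∂g.riemVolume ≤
      2 / 3 * ((∫ x, g.scalarCurvature x * Real.exp (-f x / τ) ∂g.riemVolume) +
        2 * (|1 - τ⁻¹| + 2 * C) ^ 2 * ∫ x, f x ^ 2 * Real.exp (-f x / τ) ∂g.riemVolume) := by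
  classical
  -- topology supplied by the exhaustion; `dV` finite on compact sets
  haveI : SigmaCompactSpace M := ⟨⟨fun k : ℕ ↦ {x | f x ≤ k}, fun k ↦ hprop k,
    eq_univ_of_forall fun x ↦ mem_iUnion.2 (exists_nat_ge (f x))⟩⟩
  haveI : WeaklyLocallyCompactSpace M := ⟨fun x ↦ ⟨{y | f y ≤ f x + 1}, hprop _, by
    have hopen : IsOpen {y | f y < f x + 1} := isOpen_lt hf.continuous continuous_const
    exact mem_of_superset (hopen.mem_nhds (show x ∈ {y | f y < f x + 1} from lt_add_one (f x)))
      fun y hy ↦ show f y ≤ f x + 1 from le_of_lt hy⟩⟩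
  haveI := isFiniteMeasureOnCompacts_riemVolume hg
  have hτ0 : τ ≠ 0 := hτ.ne'
  have hρ0 : 0 < ρ := one_pos.trans_le hρ
  have hC0 : 0 ≤ C := (abs_nonneg _).trans (hC 0)
  have hf0 : ∀ x, 0 ≤ f x := fun x ↦ by linarith [hnorm x, hR0 x, g.gradSq_nonneg hg f x]
  -- notation
  set N : M → ℝ := fun x ↦ g.normSq x (g.ricci x) with hNdef
  set X : M → ℝ := fun x ↦ g.innerDual x (mvfderiv (𝓡 n) g.scalarCurvature x).toLinearMap
    (mvfderiv (𝓡 n) f x).toLinearMap with hXdef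
  set C' : ℝ := |1 - τ⁻¹| + 2 * C with hC'def
  have hC'0 : 0 ≤ C' := by positivity
  have hN0 : ∀ x, 0 ≤ N x := fun x ↦ g.normSq_nonneg x hg _
  -- continuity of the players
  have hNc : Continuous N := (g.contMDiff_normSq_ricci').continuous
  have hS1 : ContMDiff (𝓡 n) 𝓘(ℝ, ℝ) 1 g.scalarCurvature :=
    (PseudoRiemannianMetric.contMDiff_scalarCurvature g).of_le ENat.LEInfty.out
  have hS2 : ContMDiff (𝓡 n) 𝓘(ℝ, ℝ) 2 g.scalarCurvature :=
    (PseudoRiemannianMetric.contMDiff_scalarCurvature g).of_le ENat.LEInfty.out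
  have hf1 : ContMDiff (𝓡 n) 𝓘(ℝ, ℝ) 1 f := hf.of_le ENat.LEInfty.out
  have hXc : Continuous X := continuous_innerDual_mvfderiv g hS1 hf1
  have hRc : Continuous fun x ↦ g.scalarCurvature x :=
    (PseudoRiemannianMetric.contMDiff_scalarCurvature g).continuous
  have hEc : Continuous fun x ↦ Real.exp (-f x / τ) :=
    Real.continuous_exp.comp (hf.continuous.neg.div_const _)
  have hφc : Continuous fun x ↦ φ (f x / ρ) := hφs.continuous.comp (hf.continuous.div_const _)
  have hφ'c : Continuous fun x ↦ deriv φ (f x / ρ) :=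
    (hφs.continuous_deriv ENat.LEInfty.out).comp (hf.continuous.div_const _)
  -- the profile `Ψ(t) = φ(t/ρ)² e^{-t/τ}` and its derivative
  set Ψ : ℝ → ℝ := fun t ↦ φ (t / ρ) ^ 2 * Real.exp (-t / τ) with hΨ
  set Ψ' : ℝ → ℝ := fun t ↦ 2 * φ (t / ρ) * (deriv φ (t / ρ) / ρ) * Real.exp (-t / τ) +
    φ (t / ρ) ^ 2 * (Real.exp (-t / τ) * (-1 / τ)) with hΨ'
  have hζd : ∀ t, HasDerivAt (fun s : ℝ ↦ φ (s / ρ)) (deriv φ (t / ρ) / ρ) t := fun t ↦ by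
    have h1 : HasDerivAt (fun s : ℝ ↦ s / ρ) (1 / ρ) t := (hasDerivAt_id t).div_const _
    have h2 : HasDerivAt φ (deriv φ (t / ρ)) (t / ρ) :=
      (hφs.differentiable (by norm_num) _).hasDerivAt
    simpa [div_eq_mul_inv, Function.comp_def] using h2.comp t h1
  have hΨd : ∀ t, HasDerivAt Ψ (Ψ' t) t := fun t ↦ by
    have h2 : HasDerivAt (fun s : ℝ ↦ φ (s / ρ) ^ 2) (2 * φ (t / ρ) * (deriv φ (t / ρ) / ρ)) t := by
      have hfun : (fun s : ℝ ↦ φ (s / ρ) ^ 2) = fun s ↦ φ (s / ρ) * φ (s / ρ) := funext fun s ↦ sq _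
      rw [hfun]
      exact ((hζd t).mul (hζd t)).congr_deriv (by ring)
    exact h2.mul (weightedIdentity_hasDerivAt_expNegDiv τ t)
  have hΨs : ContDiff ℝ ∞ Ψ :=
    ((hφs.comp (contDiff_id.div_const _)).pow 2).mul
      (Real.contDiff_exp.comp (contDiff_neg.div_const τ))
  -- the test function `u = Ψ ∘ f = φ(f/ρ)² e^{-f/τ}`: `C¹`, compact support in `{f ≤ 2ρ}`
  set u : M → ℝ := fun x ↦ Ψ (f x) with hu
  have hus : ContMDiff (𝓡 n) 𝓘(ℝ, ℝ) 1 u := (hΨs.comp_contMDiff hf).of_le ENat.LEInfty.out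
  have hsupp : ∀ x, 2 * ρ < f x → φ (f x / ρ) = 0 := fun x hx ↦
    hφ0 _ (by rw [le_div_iff₀ hρ0]; linarith)
  have huc : HasCompactSupport u := by
    refine HasCompactSupport.intro (hprop (2 * ρ)) fun x hx ↦ ?_
    simp only [hu, hΨ, hsupp x (lt_of_not_ge hx)]
    ring
  have hΨ'c0 : ∀ x, x ∉ {x | f x ≤ 2 * ρ} → Ψ' (f x) = 0 := fun x hx ↦ by
    simp only [hΨ', hsupp x (lt_of_not_ge hx)]
    ring
  -- Green's identity for `u` against `R`
  have hGreen : ∫ x, u x * g.dalembertian g.scalarCurvature x ∂g.riemVolume =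
      -∫ x, g.innerDual x (mvfderiv (𝓡 n) u x).toLinearMap
        (mvfderiv (𝓡 n) g.scalarCurvature x).toLinearMap ∂g.riemVolume := by
    haveI := (PseudoRiemannianMetric.ofRiemannian (g.toContMDiffRiemannianMetric hg)).hasLeviCivita
    have h1 := integral_mul_dalembertian_eq_neg_integral_innerDual_of_hasCompactSupport
      (g.toContMDiffRiemannianMetric hg) hus huc hS2
    rw [PseudoRiemannianMetric.riemVolume_eq hg]
    exact h1
  -- the chain rule `du = Ψ′(f) df` inside `g⁻¹(du, dR)`
  have hdu : ∀ x, g.innerDual x (mvfderiv (𝓡 n) u x).toLinearMap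
      (mvfderiv (𝓡 n) g.scalarCurvature x).toLinearMap = Ψ' (f x) * X x := fun x ↦ by
    have hfx : MDifferentiableAt (𝓡 n) 𝓘(ℝ, ℝ) f x := hf.mdifferentiableAt (by norm_num)
    have hd : (mvfderiv (𝓡 n) u x).toLinearMap = (Ψ' (f x)) • (mvfderiv (𝓡 n) f x).toLinearMap := by
      ext w
      have := mvfderiv_real_comp_apply (I := 𝓡 n) (hΨd (f x)) hfx w
      simpa [hu, Function.comp_def] using this
    rw [hd]
    have h1 : g.innerDual x (Ψ' (f x) • (mvfderiv (𝓡 n) f x).toLinearMap)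
        (mvfderiv (𝓡 n) g.scalarCurvature x).toLinearMap =
        Ψ' (f x) * g.innerDual x (mvfderiv (𝓡 n) f x).toLinearMap
          (mvfderiv (𝓡 n) g.scalarCurvature x).toLinearMap := by
      simp only [PseudoRiemannianMetric.innerDual, LinearMap.smul_apply, smul_eq_mul]
    rw [h1, g.innerDual_comm x]
  -- Hamilton's identity, multiplied by `u`
  have hHam : ∀ x, u x * g.dalembertian g.scalarCurvature x =
      u x * X x + u x * g.scalarCurvature x - 2 * (u x * N x) := fun x ↦ by
    rw [dalembertian_scalarCurvature_of_soliton g hf hsol x]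
    simp only [hXdef, hNdef]
    ring
  -- integrability of the compactly supported continuous integrands
  have huc' : Continuous u := hus.continuous
  have iuX : Integrable (fun x ↦ u x * X x) g.riemVolume :=
    (huc'.mul hXc).integrable_of_hasCompactSupport huc.mul_right
  have iuR : Integrable (fun x ↦ u x * g.scalarCurvature x) g.riemVolume :=
    (huc'.mul hRc).integrable_of_hasCompactSupport huc.mul_right
  have iuN : Integrable (fun x ↦ u x * N x) g.riemVolume :=
    (huc'.mul hNc).integrable_of_hasCompactSupport huc.mul_right
  have hΨ'fc : Continuous fun x ↦ Ψ' (f x) := by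
    simp only [hΨ']
    exact ((((continuous_const.mul hφc).mul (hφ'c.div_const _)).mul hEc).add
      ((hφc.pow 2).mul (hEc.mul continuous_const)))
  have hΨ'supp : HasCompactSupport fun x ↦ Ψ' (f x) :=
    HasCompactSupport.intro (hprop (2 * ρ)) hΨ'c0
  have iΨ'X : Integrable (fun x ↦ Ψ' (f x) * X x) g.riemVolume :=
    (hΨ'fc.mul hXc).integrable_of_hasCompactSupport hΨ'supp.mul_right
  -- integrate Hamilton's identity: `2 ∫ uN = ∫ uX + ∫ uR + ∫ Ψ′(f) X`
  have hint : 2 * ∫ x, u x * N x ∂g.riemVolume =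
      (∫ x, u x * X x ∂g.riemVolume) + (∫ x, u x * g.scalarCurvature x ∂g.riemVolume) +
        ∫ x, Ψ' (f x) * X x ∂g.riemVolume := by
    have h1 : ∫ x, u x * g.dalembertian g.scalarCurvature x ∂g.riemVolume =
        (∫ x, u x * X x ∂g.riemVolume) + (∫ x, u x * g.scalarCurvature x ∂g.riemVolume) -
          2 * ∫ x, u x * N x ∂g.riemVolume := by
      have iAB : Integrable (fun x ↦ u x * X x + u x * g.scalarCurvature x) g.riemVolume := iuX.add iuR
      have iC : Integrable (fun x ↦ 2 * (u x * N x)) g.riemVolume := iuN.const_mul 2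
      simp_rw [hHam]
      rw [integral_sub iAB iC, integral_add iuX iuR, integral_const_mul]
    have h2 : ∫ x, g.innerDual x (mvfderiv (𝓡 n) u x).toLinearMap
        (mvfderiv (𝓡 n) g.scalarCurvature x).toLinearMap ∂g.riemVolume =
        ∫ x, Ψ' (f x) * X x ∂g.riemVolume := integral_congr_ae (Eventually.of_forall hdu)
    rw [h1, h2] at hGreen
    linarith
  -- pointwise bounds: `uR ≤ R v`, `(u + Ψ′(f)) X ≤ v (½ φ² N + 2 C′² f²)`
  have hXabs : ∀ x, |X x| ≤ 2 * Real.sqrt (N x) * f x := fun x ↦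
    ricciNormSq_abs_innerDual_le hg hf hsol hnorm hR0 x
  have hkey : ∀ x, u x * X x + Ψ' (f x) * X x ≤
      Real.exp (-f x / τ) * (1 / 2 * (φ (f x / ρ) ^ 2 * N x) + 2 * C' ^ 2 * f x ^ 2) := fun x ↦ by
    have hφx := hφ01 (f x / ρ)
    have hv0 : 0 < Real.exp (-f x / τ) := Real.exp_pos _
    -- the coefficient `c = φ (1 − τ⁻¹) + 2 φ′/ρ`, `|c| ≤ C′`
    set c : ℝ := φ (f x / ρ) * (1 - τ⁻¹) + 2 * (deriv φ (f x / ρ) / ρ) with hc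
    have hsum : u x + Ψ' (f x) = Real.exp (-f x / τ) * φ (f x / ρ) * c := by
      simp only [hu, hΨ, hΨ', hc]
      field_simp
      ring
    have hcabs : |c| ≤ C' := by
      have h1 : |φ (f x / ρ) * (1 - τ⁻¹)| ≤ |1 - τ⁻¹| := by
        rw [abs_mul, abs_of_nonneg hφx.1]
        exact mul_le_of_le_one_left (abs_nonneg _) hφx.2
      have h2 : |2 * (deriv φ (f x / ρ) / ρ)| ≤ 2 * C := by
        rw [abs_mul, abs_of_pos two_pos, abs_div, abs_of_pos hρ0]
        refine mul_le_mul_of_nonneg_left ?_ zero_le_two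
        exact (div_le_self (abs_nonneg _) hρ).trans (hC _)
      calc |c| ≤ |φ (f x / ρ) * (1 - τ⁻¹)| + |2 * (deriv φ (f x / ρ) / ρ)| := abs_add_le _ _
        _ ≤ C' := by rw [hC'def]; linarith
    -- `a = φ √N`, `b = C′ f`: `|φ c X| ≤ 2 a b ≤ a²/2 + 2 b²`
    have hs0 : 0 ≤ Real.sqrt (N x) := Real.sqrt_nonneg _
    have hss : Real.sqrt (N x) ^ 2 = N x := Real.sq_sqrt (hN0 x)
    have hprod : φ (f x / ρ) * c * X x ≤
        1 / 2 * (φ (f x / ρ) ^ 2 * N x) + 2 * C' ^ 2 * f x ^ 2 := by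
      have h1 : φ (f x / ρ) * c * X x ≤ φ (f x / ρ) * (C' * (2 * Real.sqrt (N x) * f x)) := by
        rw [mul_assoc]
        refine mul_le_mul_of_nonneg_left ?_ hφx.1
        calc c * X x ≤ |c * X x| := le_abs_self _
          _ = |c| * |X x| := abs_mul _ _
          _ ≤ C' * (2 * Real.sqrt (N x) * f x) :=
              mul_le_mul hcabs (hXabs x) (abs_nonneg _) hC'0
      have h2 : φ (f x / ρ) * (C' * (2 * Real.sqrt (N x) * f x)) =
          2 * (φ (f x / ρ) * Real.sqrt (N x)) * (C' * f x) := by ring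
      have h3 : 2 * (φ (f x / ρ) * Real.sqrt (N x)) * (C' * f x) ≤
          1 / 2 * (φ (f x / ρ) * Real.sqrt (N x)) ^ 2 + 2 * (C' * f x) ^ 2 := by
        nlinarith [sq_nonneg (φ (f x / ρ) * Real.sqrt (N x) - 2 * (C' * f x))]
      calc φ (f x / ρ) * c * X x ≤ 2 * (φ (f x / ρ) * Real.sqrt (N x)) * (C' * f x) := h1.trans_eq h2
        _ ≤ 1 / 2 * (φ (f x / ρ) * Real.sqrt (N x)) ^ 2 + 2 * (C' * f x) ^ 2 := h3
        _ = 1 / 2 * (φ (f x / ρ) ^ 2 * N x) + 2 * C' ^ 2 * f x ^ 2 := by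
            rw [mul_pow, mul_pow, hss]
            ring
    calc u x * X x + Ψ' (f x) * X x = (u x + Ψ' (f x)) * X x := by ring
      _ = Real.exp (-f x / τ) * (φ (f x / ρ) * c * X x) := by rw [hsum]; ring
      _ ≤ Real.exp (-f x / τ) * (1 / 2 * (φ (f x / ρ) ^ 2 * N x) + 2 * C' ^ 2 * f x ^ 2) :=
          mul_le_mul_of_nonneg_left hprod hv0.le
  have huR : ∀ x, u x * g.scalarCurvature x ≤ g.scalarCurvature x * Real.exp (-f x / τ) := fun x ↦ by
    have hφx := hφ01 (f x / ρ)
    have hφ2 : φ (f x / ρ) ^ 2 ≤ 1 := by nlinarith [hφx.1, hφx.2]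
    have h0 : 0 ≤ g.scalarCurvature x * Real.exp (-f x / τ) := mul_nonneg (hR0 x) (Real.exp_pos _).le
    calc u x * g.scalarCurvature x = φ (f x / ρ) ^ 2 * (g.scalarCurvature x * Real.exp (-f x / τ)) := by
          simp only [hu, hΨ]; ring
      _ ≤ 1 * (g.scalarCurvature x * Real.exp (-f x / τ)) := mul_le_mul_of_nonneg_right hφ2 h0
      _ = g.scalarCurvature x * Real.exp (-f x / τ) := one_mul _
  -- the weights on the right are integrable
  obtain ⟨-, -, iR⟩ := weightedIntegrability_riemVolume hg hf hsol hnorm hprop hR0 hτ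
  obtain ⟨iF2, -⟩ := secondWeightedIdentity_integrable hg hf hsol hnorm hprop hR0 hτ
  have iφN : Integrable (fun x ↦ φ (f x / ρ) ^ 2 * (N x * Real.exp (-f x / τ))) g.riemVolume :=
    iuN.congr (Eventually.of_forall fun x ↦ by simp only [hu, hΨ]; ring)
  -- integrate the bounds
  have hI1 : (∫ x, u x * X x ∂g.riemVolume) + ∫ x, Ψ' (f x) * X x ∂g.riemVolume ≤
      1 / 2 * (∫ x, φ (f x / ρ) ^ 2 * (N x * Real.exp (-f x / τ)) ∂g.riemVolume) +
        2 * C' ^ 2 * ∫ x, f x ^ 2 * Real.exp (-f x / τ) ∂g.riemVolume := by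
    have i1 : Integrable (fun x ↦ u x * X x + Ψ' (f x) * X x) g.riemVolume := iuX.add iΨ'X
    have hsplit : ∀ x, Real.exp (-f x / τ) * (1 / 2 * (φ (f x / ρ) ^ 2 * N x) + 2 * C' ^ 2 * f x ^ 2) =
        1 / 2 * (φ (f x / ρ) ^ 2 * (N x * Real.exp (-f x / τ))) +
          2 * C' ^ 2 * (f x ^ 2 * Real.exp (-f x / τ)) := fun x ↦ by ring
    have i2 : Integrable (fun x ↦ Real.exp (-f x / τ) *
        (1 / 2 * (φ (f x / ρ) ^ 2 * N x) + 2 * C' ^ 2 * f x ^ 2)) g.riemVolume := by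
      have h12 : Integrable (fun x ↦ 1 / 2 * (φ (f x / ρ) ^ 2 * (N x * Real.exp (-f x / τ))) +
          2 * C' ^ 2 * (f x ^ 2 * Real.exp (-f x / τ))) g.riemVolume :=
        (iφN.const_mul _).add (iF2.const_mul _)
      exact h12.congr (Eventually.of_forall fun x ↦ (hsplit x).symm)
    calc (∫ x, u x * X x ∂g.riemVolume) + ∫ x, Ψ' (f x) * X x ∂g.riemVolume
        = ∫ x, (u x * X x + Ψ' (f x) * X x) ∂g.riemVolume := (integral_add iuX iΨ'X).symm
      _ ≤ ∫ x, Real.exp (-f x / τ) *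
          (1 / 2 * (φ (f x / ρ) ^ 2 * N x) + 2 * C' ^ 2 * f x ^ 2) ∂g.riemVolume :=
          integral_mono i1 i2 hkey
      _ = 1 / 2 * (∫ x, φ (f x / ρ) ^ 2 * (N x * Real.exp (-f x / τ)) ∂g.riemVolume) +
          2 * C' ^ 2 * ∫ x, f x ^ 2 * Real.exp (-f x / τ) ∂g.riemVolume := by
          simp_rw [hsplit]
          rw [integral_add (iφN.const_mul _) (iF2.const_mul _), integral_const_mul,
            integral_const_mul]
  have hI2 : ∫ x, u x * g.scalarCurvature x ∂g.riemVolume ≤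
      ∫ x, g.scalarCurvature x * Real.exp (-f x / τ) ∂g.riemVolume := integral_mono iuR iR huR
  have hI3 : ∫ x, u x * N x ∂g.riemVolume =
      ∫ x, φ (f x / ρ) ^ 2 * (N x * Real.exp (-f x / τ)) ∂g.riemVolume :=
    integral_congr_ae (Eventually.of_forall fun x ↦ by simp only [hu, hΨ]; ring)
  -- absorb
  have hfin : 2 * ∫ x, φ (f x / ρ) ^ 2 * (N x * Real.exp (-f x / τ)) ∂g.riemVolume ≤
      (∫ x, g.scalarCurvature x * Real.exp (-f x / τ) ∂g.riemVolume) +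
        (1 / 2 * (∫ x, φ (f x / ρ) ^ 2 * (N x * Real.exp (-f x / τ)) ∂g.riemVolume) +
          2 * C' ^ 2 * ∫ x, f x ^ 2 * Real.exp (-f x / τ) ∂g.riemVolume) := by
    rw [← hI3, hint]
    linarith
  simp only [hNdef] at hfin ⊢
  linarith

end ProperGreen

/-! ## The registered helper (n = 4, crux vocabulary) -/

/-- **Helper `helper_ricciNormSq_cutoff_integral_le` of line `Sketch`** (the cut-off inequality of
Munteanu–Sesum's weighted `L²` bound, `n = 4`): on every complete connected normalised 4-d gradient
shrinking Ricci soliton, for every smooth profile `φ` vanishing on `[2, ∞)` with `0 ≤ φ ≤ 1` and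
`|φ′| ≤ C`, every `ρ ≥ 1` and every `τ > 0`,
`∫ φ(f/ρ)² |Ric|² e^{-f/τ} dV ≤ ⅔ (∫ R e^{-f/τ} dV + 2 (|1 − τ⁻¹| + 2C)² ∫ f² e^{-f/τ} dV)` (`dV` the
Riemannian measure of `g.toContMDiffRiemannianMetric hg`): `R ≥ 0` and properness of `f`
(`NoncompactShrinkerGapCarrilloNiClauses.scalarCurvature_nonneg_and_isCompact_sublevel`), then
`ricciNormSq_cutoff_integral_le`. -/
theorem helper_ricciNormSq_cutoff_integral_le : ∀ (M : Type) [TopologicalSpace M] [T2Space M] [SecondCountableTopology M] [ChartedSpace (EuclideanSpace ℝ (Fin 4)) M] [IsManifold (𝓡 4) ∞ M] [ConnectedSpace M] [T3Space M] [MeasurableSpace M] [BorelSpace M] (g : Literature.Geometry.Lorentzian.PseudoRiemannianMetric (𝓡 4) ∞ (EuclideanSpace ℝ (Fin 4)) (TangentSpace (𝓡 4) : M → Type _)) [g.HasLeviCivita] (f : M → ℝ) (hg : g.IsRiemannian), (∀ (x : M) (r : NNReal), IsCompact {y : M | g.edist hg x y ≤ r}) → ContMDiff (𝓡 4) 𝓘(ℝ,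 ℝ) ∞ f → (∀ (x : M) (X Y : TangentSpace (𝓡 4) x), g.ricci x X Y + g.hessian f x X Y = (1 / 2 : ℝ) * g.val x X Y) → (∀ x : M, g.scalarCurvature x + g.gradSq f x = f x) → ∀ (φ : ℝ → ℝ) (C ρ τ : ℝ), ContDiff ℝ ∞ φ → (∀ t, 2 ≤ t → φ t = 0) → (∀ t, 0 ≤ φ t ∧ φ t ≤ 1) → (∀ t, |deriv φ t| ≤ C) → 1 ≤ ρ → 0 < τ → ∫ x, φ (f x / ρ) ^ 2 * (g.normSq x (g.ricci x) * Real.exp (-f x / τ)) ∂(Literature.Geometry.Lorentzian.riemannianMeasure (g.toContMDiffRiemannianMetric hg)) ≤ 2 / 3 * ((∫ x, g.scalarCurvature x * Real.exp (-f x / τ) ∂(Literature.Geometry.Lorentzian.riemannianMeasure (g.toContMDiffRiemannianMetric hg))) + 2 * (|1 - τ⁻¹| + 2 * C) ^ 2 * ∫ x, f x ^ 2 * Real.exp (-f x / τ) ∂(Literature.Geometry.Lorentzian.riemannianMeasure (g.toContMDiffRiemannianMetric hg))) := by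
  intro M _ _ _ _ _ _ _ _ _ g _ f hg hc hf hsol hnorm φ C ρ τ hφs hφ0 hφ01 hC hρ hτ
  obtain ⟨hR0, -, hprop⟩ :=
    NoncompactShrinkerGapCarrilloNiClauses.scalarCurvature_nonneg_and_isCompact_sublevel g f hg hc hf
      hsol hnorm
  rw [← PseudoRiemannianMetric.riemVolume_eq hg]
  exact ricciNormSq_cutoff_integral_le hg hf hsol hnorm hprop hR0 hφs hφ0 hφ01 hC hρ hτ

end Summit.SmoothPoincare4.SmoothPoincare4.Theorems.ConicalGapSketch

end
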